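import Mathlib.NumberTheory.ModularForms.JacobiTheta.OneVariable
import Mathlib.Analysis.SpecialFunctions.Pow.Complex
import Mathlib.Analysis.SpecialFunctions.Pow.Real
import Literature.NumberTheory.EllipticCurves.HalfIntegralWeightThetaMultiplier
import HarnessLib

set_option autoImplicit false

/-!
# Crux `PrintCFram.BottomClassIndexLawFiveLe` (stmt-BirchSwinnertonDyer-20372), line `eisenstein-resource-bdp-line` (registry v24):
# CUSP-GLUE GENERICS (α) — JACOBI'S INVERSION FOR THE THETA FACTOR AT THE CUSP `0`:
# `y^{1/2} · θ_t(iy) → 1/√(2t)` as `y → 0⁺`, and the quotient socket between Lemma A (the cusp constant of the weight-`k`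
# vehicle `F = F_e · θ_t`) and (E4) (the Abel limit of the Dirichlet coefficients of `F_e`)
# (cell `bsd-print-cfram`, width seat `bsd-line-cfram-p1-w8` g8; THEOREMS ONLY, `--supports` 20372; Mathlib currency;
# BSD is not proved by any of this)

HONEST FRAMING. Nothing here is a statement about elliptic curves or BSD; no registered stub is closed. In the proof plan for the
cusp conjunct (iii) of registry v24's `stub_cuspCutForm` (crux notes `Lines/eisenstein-resource-bdp-line-w5g5-cusp-seed.md` §§2, 15)
the `m`-cut Cohen–Eisenstein series `F_e` (half-integral weight `k + 1/2`, not a kernel object) is carried by the INTEGRAL-weight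
vehicle `F = F_e · θ(Q²·)` (seat w8 g7's bridge, seat w3 g12's periodic cut; weight `k + 1`). Lemma A (`CuspSeed.tendsto_zpow_mul_apply_ofComplex_I_mul`,
p691154) gives `y^{k+1} F(iy) → Λ := i^{k+1}·CT_0(F)`; (E4) (`CuspSeed.tendsto_sub_mul_LSeries_of_tendsto_rpow_smul_tsum`, p695659) wants
the Abel limit `t^{k+1/2} · Σ a(n) e^{−2πnt} → ℓ` of the coefficients `a` of `F_e` ALONE. This file supplies the missing factor:
* §1 `θ_t(iy) = jacobiTheta (i·2ty)` and JACOBI'S INVERSION on the imaginary axis: `θ_t(iy) = (2ty)^{−1/2} · jacobiTheta (i/(2ty))`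
  (Mathlib `jacobiTheta_S_smul`), `jacobiTheta τ → 1` as `im τ → ∞` (Mathlib `isBigO_at_im_infty_jacobiTheta_sub_one`), hence
  **`y^{1/2} · θ_t(iy) → 1/√(2t)`** as `y → 0⁺` (`tendsto_cpow_half_mul_thetaMul`);
* §2 THE QUOTIENT SOCKET: if `F(iy) = (Σ' a(n) e^{−2πny}) · θ_t(iy)` for small `y > 0` and `y^k F(iy) → Λ` (`k : ℤ`), then
  `t ↦ t^{k − 1/2} • Σ' a(n) e^{−2πnt}` tends to `Λ · √(2t)` as `t → 0⁺` — EXACTLY the hypothesis `hlim` of (E4), with `w = k − 1/2`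
  and `ℓ = Λ·√(2t)` (`tendsto_rpow_smul_tsum_of_eq_mul_thetaMul`).
With `t = Q²`: `√(2t) = Q√2`. beyond-print theorem: NO (Jacobi 1829 / Mathlib).

References: [DiamondShurman2005] §1.2; Mathlib `Mathlib.NumberTheory.ModularForms.JacobiTheta.OneVariable`; crux notes
`Lines/eisenstein-resource-bdp-line-w5g5-cusp-seed.md` §2 (Lemma A), §15 (E).
-/

-- summit-side namespace `Summit.BirchSwinnertonDyer.BirchSwinnertonDyer.…` (single-conjunct summit, D-0017 layout)
set_option linter.dupNamespace false

noncomputable section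

namespace Summit.BirchSwinnertonDyer.BirchSwinnertonDyer.Theorems.PrintCFram.CuspGlue

open UpperHalfPlane hiding I
open Filter Function Complex Literature.NumberTheory.EllipticCurves.Tunnell1983
  Literature.NumberTheory.EllipticCurves.ModularForms
open scoped Topology Real

/-! ## §1 Jacobi's inversion for `θ_t` on the imaginary axis -/

/-- `im (i·y) = y`. [folklore] -/
theorem im_I_mul_ofReal (y : ℝ) : (I * (y : ℂ)).im = y := by
  rw [mul_comm, Complex.im_ofReal_mul, Complex.I_im, mul_one]

/-- For `y > 0` and `t ≥ 1`, the point `i/(2ty)` of `ℍ`, and `S·(i/(2ty)) = i·2ty`. [folklore] -/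
theorem im_I_div_pos {t : ℕ} (ht : 0 < t) {y : ℝ} (hy : 0 < y) : 0 < (I / (2 * (t : ℂ) * y)).im := by
  have h : I / (2 * (t : ℂ) * y) = I * (((2 * t * y)⁻¹ : ℝ) : ℂ) := by
    push_cast
    rw [div_eq_mul_inv]
  rw [h, im_I_mul_ofReal]
  positivity

/-- **`θ_t(iy) = jacobiTheta (i · 2ty)`** (`θ_t(z) = Σ e^{2πi t m² z} = jacobiTheta (2tz)`). [folklore] -/
theorem thetaMul_ofComplex_I_mul {t : ℕ} (ht : 0 < t) {y : ℝ} (hy : 0 < y) :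
    thetaMul t (ofComplex (I * y)) = jacobiTheta (I * (2 * (t : ℂ) * y)) := by
  have hpos : 0 < (I * (y : ℂ)).im := by rw [im_I_mul_ofReal]; exact hy
  rw [thetaMul_eq_shimuraTheta ht, shimuraTheta]
  congr 1
  show 2 * ((t : ℂ) * ((ofComplex (I * (y : ℂ)) : ℍ) : ℂ)) = I * (2 * (t : ℂ) * y)
  rw [ofComplex_apply_of_im_pos hpos, coe_mk]
  ring

/-- **Jacobi's inversion on the imaginary axis**: `θ_t(iy) = (2ty)^{−1/2} · jacobiTheta (i/(2ty))` for `y > 0` (Mathlib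
`jacobiTheta_S_smul` at `τ = i/(2ty)`, where `−iτ = 1/(2ty) > 0`). [folklore] -/
theorem thetaMul_ofComplex_I_mul_eq {t : ℕ} (ht : 0 < t) {y : ℝ} (hy : 0 < y) :
    thetaMul t (ofComplex (I * y)) =
      (((2 * t * y)⁻¹ : ℝ) ^ (1 / 2 : ℝ) : ℝ) * jacobiTheta (I / (2 * (t : ℂ) * y)) := by
  set τ : ℍ := ⟨I / (2 * (t : ℂ) * y), im_I_div_pos ht hy⟩ with hτ
  have hτc : ((τ : ℍ) : ℂ) = I / (2 * (t : ℂ) * y) := rfl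
  have ht0 : (t : ℂ) ≠ 0 := by exact_mod_cast ht.ne'
  have hy0 : (y : ℂ) ≠ 0 := by exact_mod_cast hy.ne'
  -- `S · τ = i · 2ty`
  have hS : ((ModularGroup.S • τ : ℍ) : ℂ) = I * (2 * (t : ℂ) * y) := by
    rw [UpperHalfPlane.modular_S_smul, UpperHalfPlane.coe_mk, hτc, inv_neg, inv_div, Complex.div_I, neg_neg, mul_comm]
  -- `−i τ = 1/(2ty)`, a positive real
  have hIτ : -I * (τ : ℂ) = (((2 * t * y)⁻¹ : ℝ) : ℂ) := by
    rw [hτc]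
    push_cast
    field_simp
    rw [Complex.I_sq]
    ring
  rw [thetaMul_ofComplex_I_mul ht hy, ← hS, jacobiTheta_S_smul τ, hIτ]
  congr 1
  rw [Complex.ofReal_cpow (by positivity)]
  norm_num

/-- `jacobiTheta τ → 1` as `im τ → ∞` (from Mathlib's exponential bound `jacobiTheta τ − 1 = O(e^{−π im τ})`). [folklore] -/
theorem tendsto_jacobiTheta_atImInfty : Tendsto jacobiTheta (comap Complex.im atTop) (𝓝 1) := by
  have hexp : Tendsto (fun τ : ℂ => Real.exp (-π * τ.im)) (comap Complex.im atTop) (𝓝 0) := by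
    have h1 : Tendsto (fun τ : ℂ => -π * τ.im) (comap Complex.im atTop) atBot :=
      (tendsto_comap.const_mul_atTop_of_neg (neg_lt_zero.mpr Real.pi_pos))
    exact Real.tendsto_exp_atBot.comp h1
  have h := isBigO_at_im_infty_jacobiTheta_sub_one.trans_tendsto hexp
  have := h.add_const 1
  simpa using this

/-- `i/(2ty) → i∞` (in `ℂ`, along `comap im atTop`) as `y → 0⁺`. [folklore] -/
theorem tendsto_I_div_comap_im {t : ℕ} (ht : 0 < t) :
    Tendsto (fun y : ℝ => I / (2 * (t : ℂ) * y)) (𝓝[>] (0 : ℝ)) (comap Complex.im atTop) := by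
  rw [tendsto_comap_iff]
  have him : ∀ y : ℝ, (I / (2 * (t : ℂ) * y)).im = (2 * (t : ℝ))⁻¹ * y⁻¹ := by
    intro y
    have h : I / (2 * (t : ℂ) * y) = I * ((((2 * (t : ℝ))⁻¹ * y⁻¹ : ℝ)) : ℂ) := by
      push_cast
      rw [div_eq_mul_inv, mul_inv]
    rw [h, im_I_mul_ofReal]
  have hc : (0 : ℝ) < (2 * (t : ℝ))⁻¹ := by positivity
  refine Tendsto.congr (fun y => (him y).symm) ?_
  exact (tendsto_inv_nhdsGT_zero (𝕜 := ℝ)).const_mul_atTop hc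

/-- **`y^{1/2} · θ_t(iy) → 1/√(2t)` as `y → 0⁺`** (`t ≥ 1`): the behaviour of the weight-`1/2` theta factor at the cusp `0`.
[folklore] -/
theorem tendsto_cpow_half_mul_thetaMul {t : ℕ} (ht : 0 < t) :
    Tendsto (fun y : ℝ => (y : ℂ) ^ (1 / 2 : ℂ) * thetaMul t (ofComplex (I * y))) (𝓝[>] (0 : ℝ))
      (𝓝 ((Real.sqrt (2 * t))⁻¹ : ℂ)) := by
  -- for `y > 0`: `y^{1/2} θ_t(iy) = (2t)^{−1/2} · jacobiTheta (i/(2ty))`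
  have hid : ∀ y : ℝ, 0 < y → (y : ℂ) ^ (1 / 2 : ℂ) * thetaMul t (ofComplex (I * y)) =
      ((Real.sqrt (2 * t))⁻¹ : ℂ) * jacobiTheta (I / (2 * (t : ℂ) * y)) := by
    intro y hy
    rw [thetaMul_ofComplex_I_mul_eq ht hy, ← mul_assoc]
    congr 1
    have hreal : (y : ℝ) ^ (1 / 2 : ℝ) * ((2 * t * y)⁻¹) ^ (1 / 2 : ℝ) = (Real.sqrt (2 * t))⁻¹ := by
      rw [← Real.mul_rpow hy.le (by positivity), show y * (2 * (t : ℝ) * y)⁻¹ = (2 * (t : ℝ))⁻¹ by field_simp,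
        Real.inv_rpow (by positivity), Real.sqrt_eq_rpow]
    calc (y : ℂ) ^ (1 / 2 : ℂ) * ((((2 * t * y)⁻¹) ^ (1 / 2 : ℝ) : ℝ) : ℂ)
        = (((y : ℝ) ^ (1 / 2 : ℝ) : ℝ) : ℂ) * ((((2 * t * y)⁻¹) ^ (1 / 2 : ℝ) : ℝ) : ℂ) := by
          rw [Complex.ofReal_cpow hy.le]; norm_num
      _ = (((Real.sqrt (2 * t))⁻¹ : ℝ) : ℂ) := by rw [← Complex.ofReal_mul, hreal]
      _ = ((Real.sqrt (2 * t) : ℂ))⁻¹ := by rw [Complex.ofReal_inv]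
  have hev : (fun y : ℝ => (y : ℂ) ^ (1 / 2 : ℂ) * thetaMul t (ofComplex (I * y))) =ᶠ[𝓝[>] (0 : ℝ)]
      fun y => ((Real.sqrt (2 * t))⁻¹ : ℂ) * jacobiTheta (I / (2 * (t : ℂ) * y)) := by
    filter_upwards [self_mem_nhdsWithin] with y hy using hid y hy
  rw [tendsto_congr' hev]
  have h := (tendsto_jacobiTheta_atImInfty.comp (tendsto_I_div_comap_im ht)).const_mul ((Real.sqrt (2 * t))⁻¹ : ℂ)
  simpa using h

/-! ## §2 The quotient socket: from Lemma A on `F = F_e·θ_t` to the Abel limit of the coefficients of `F_e` -/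

/-- For `y > 0` and `k : ℤ`: `y^k = y^{k − 1/2} · y^{1/2}` with the first factor a real power, as complex numbers. [folklore] -/
theorem ofReal_zpow_eq_rpow_mul_cpow {y : ℝ} (hy : 0 < y) (k : ℤ) :
    (y : ℂ) ^ k = ((y ^ ((k : ℝ) - 1 / 2) : ℝ) : ℂ) * (y : ℂ) ^ (1 / 2 : ℂ) := by
  rw [show ((y : ℂ) ^ (1 / 2 : ℂ)) = ((y ^ (1 / 2 : ℝ) : ℝ) : ℂ) by rw [Complex.ofReal_cpow hy.le]; norm_num,
    ← Complex.ofReal_mul, ← Real.rpow_add hy, show (k : ℝ) - 1 / 2 + 1 / 2 = ((k : ℤ) : ℝ) by ring,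
    Real.rpow_intCast, Complex.ofReal_zpow]

/-- **The quotient socket.** Let `F : ℍ → ℂ`, `a : ℕ → ℂ`, `t ≥ 1`, `k : ℤ`. If, for all small `y > 0`,
`F(iy) = (Σ' a(n) e^{−2πny}) · θ_t(iy)` and `y^k · F(iy) → Λ` as `y → 0⁺` (Lemma A for the weight-`k` vehicle at the cusp `0`),
then `y^{k−1/2} • Σ' a(n) e^{−2πny} → Λ·√(2t)` as `y → 0⁺` — the hypothesis `hlim` of (E4)
`CuspSeed.tendsto_sub_mul_LSeries_of_tendsto_rpow_smul_tsum` with `w = k − 1/2`, `ℓ = Λ·√(2t)`. [folklore] -/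
theorem tendsto_rpow_smul_tsum_of_eq_mul_thetaMul {F : ℍ → ℂ} {a : ℕ → ℂ} {t : ℕ} (ht : 0 < t) {k : ℤ} {Λ : ℂ}
    (hF : ∀ᶠ y : ℝ in 𝓝[>] (0 : ℝ), F (ofComplex (I * y)) =
      (∑' n : ℕ, a n * (Real.exp (-(2 * π * n * y)) : ℂ)) * thetaMul t (ofComplex (I * y)))
    (hlim : Tendsto (fun y : ℝ => (y : ℂ) ^ k * F (ofComplex (I * y))) (𝓝[>] (0 : ℝ)) (𝓝 Λ)) :
    Tendsto (fun y : ℝ => (y ^ ((k : ℝ) - 1 / 2)) • ∑' n : ℕ, a n * (Real.exp (-(2 * π * n * y)) : ℂ))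
      (𝓝[>] (0 : ℝ)) (𝓝 (Λ * (Real.sqrt (2 * t) : ℂ))) := by
  have hθ := tendsto_cpow_half_mul_thetaMul ht
  have hne : ((Real.sqrt (2 * t))⁻¹ : ℂ) ≠ 0 := by
    rw [Ne, inv_eq_zero, Complex.ofReal_eq_zero]
    exact (Real.sqrt_pos.mpr (by positivity)).ne'
  -- eventually the theta factor is non-zero, and the quotient identity holds
  have hθne : ∀ᶠ y : ℝ in 𝓝[>] (0 : ℝ), (y : ℂ) ^ (1 / 2 : ℂ) * thetaMul t (ofComplex (I * y)) ≠ 0 :=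
    hθ.eventually_ne hne
  have hev : (fun y : ℝ => (y ^ ((k : ℝ) - 1 / 2)) • ∑' n : ℕ, a n * (Real.exp (-(2 * π * n * y)) : ℂ)) =ᶠ[𝓝[>] (0 : ℝ)]
      fun y => ((y : ℂ) ^ k * F (ofComplex (I * y))) / ((y : ℂ) ^ (1 / 2 : ℂ) * thetaMul t (ofComplex (I * y))) := by
    filter_upwards [hF, hθne, self_mem_nhdsWithin] with y hFy hθy hy
    rw [hFy, ofReal_zpow_eq_rpow_mul_cpow hy k, Complex.real_smul, eq_div_iff hθy]
    ring
  rw [tendsto_congr' hev]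
  have h := hlim.div hθ hne
  rw [div_inv_eq_mul] at h
  exact h

end Summit.BirchSwinnertonDyer.BirchSwinnertonDyer.Theorems.PrintCFram.CuspGlue

end
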